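import Literature.MathematicalPhysics.QuantumFieldTheory.ONArchipelagoTwoSign
import Literature.MathematicalPhysics.QuantumFieldTheory.ConformalBootstrap3D.TwoSignHeadCells
import HarnessLib

/-!
# The light `T` and `A` rows of an `O(N)` archipelago point certificate from two-sign head cells

Eleventh file of the archipelago rung.  `ONArchipelagoTwoSign.lean` identified the traceless-symmetric
(`T`) and antisymmetric (`A`) rows of a point 7-vector with TWO-SIGN ROWS
`φ_{a⁻}[F^{Δ_φ}_-] + φ_{a⁺}[F^{Δ_φ}_+]` (combined weights `tensorMinusWeights/PlusWeights`,
`antiMinusWeights/PlusWeights`) and closed their tails; this file closes the LIGHT `T`/`A` rows — the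
items `scalar_T` (`ℓ = 0`, `Δ ∈ [max(Δ_T^*, 1/2), E₀)`), `spinning_T` (even `ℓ ≠ 0`) and `spinning_A`
(odd `ℓ`), `Δ ∈ [ℓ+1, E₀)`, of `ArchipelagoObligations` — by the TWO-SIGN HEAD CELLS of
`ConformalBootstrap3D/TwoSignHeadCells.lean`: one number `headCellNumber₂ ≥ 0` per `Δ`-cell `[a, b)`
(corner or chord term bounds, monotone or interval coefficient tables — two rule bits), the tail terms
off the head set discharged by the row's rules (M) on `[E₀, E_T)` and the ONE apex inequality (T), the
external dimension running over the whole interval `[φ_lo, φ_hi]` ⇒ `TensorPositive` / `AntiPositive`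
on the cell at every `p ∈ Q` (`tensorCell_of_headNumber₂`, `antiCell_of_headNumber₂`); cells glue
(`tensorPositive_of_cells`, `antiPositive_of_cells`) into the items (`scalar_T_of_cells`,
`spinning_T_of_cells`, `spinning_A_of_cells`).

With this file and `ONArchipelagoSingletHead` / `ONArchipelagoVectorHead` every item of
`ArchipelagoObligations` except the external form at the isolated points is the conclusion of a
closed-form kernel rule over the node data of the point 7-vector.  No table, no number, no `sorry`.

Sources: arXiv:1504.07997 §§2.1–2.2 (`KosPolandSimmonsDuffinVichi2015`); F. Kos, D. Poland,
D. Simmons-Duffin, JHEP 06 (2014) 091, §2.1 (`KosPolandSimmonsduffin2014ON`); M. Hogervorst,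
S. Rychkov, Phys. Rev. D 87 (2013) 106004, §3 eqs. (3.6), (3.9) (`HogervorstRychkov2013`).
-/

noncomputable section

namespace Literature.MathematicalPhysics.QuantumFieldTheory.ONArchipelagoSystem

open Finset Set Filter Topology
open ConformalBootstrap3D (unitarityBound3D TwoSignPositive twoSignTerm apexRest₂ headCellNumber₂
  headCell₂_twoSign_of_rules)

namespace ArchipelagoFunctional

/-! ### Cells cover ranges (any row predicate) -/

/-- Half-open cells `[t_i, t_{i+1})`, `i < m`, with `t_0 ≤ lo`, `hi ≤ t_m`, each carrying a row
predicate `P p Δ` on `Q`, cover every `Δ ∈ [lo, hi)`. Elementary bookkeeping of the cell lists.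
[cite: KosPolandSimmonsduffin2014ON, §2.1 (vector sum rule)] -/
theorem cells_cover {Q : Set (ℝ × ℝ)} (P : ℝ × ℝ → ℝ → Prop) (t : ℕ → ℝ) (m : ℕ) {lo hi : ℝ}
    (hlo : t 0 ≤ lo) (hhi : hi ≤ t m)
    (hcell : ∀ i < m, ∀ p ∈ Q, ∀ Δ ∈ Ico (t i) (t (i + 1)), P p Δ) :
    ∀ p ∈ Q, ∀ Δ : ℝ, lo ≤ Δ → Δ < hi → P p Δ := by
  intro p hp Δ h1 h2
  have hΔm : Δ < t m := lt_of_lt_of_le h2 hhi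
  have h0 : t 0 ≤ Δ := hlo.trans h1
  have hex : ∃ i, i < m ∧ t i ≤ Δ ∧ Δ < t (i + 1) := by
    by_contra hne
    push Not at hne
    have key : ∀ i, i ≤ m → t i ≤ Δ := by
      intro i
      induction i with
      | zero => intro _; exact h0
      | succ i ih =>
        intro hi'
        exact hne i (by omega) (ih (by omega))
    exact absurd (key m le_rfl) (not_le.2 hΔm)
  obtain ⟨i, him, hi1, hi2⟩ := hex
  exact hcell i him p hp Δ ⟨hi1, hi2⟩

/-! ### One light `T` / `A` cell from its two-sign head number -/

/-- **One light `T` cell from its number.** Dominated configuration (apex `a₀` with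
`a⁻_{a₀} + a⁺_{a₀} ≥ 0` for the `T` combined weights), `Q ⊆ [φ_lo, φ_hi] × ℝ`, the `T` tail rules in
force — (M) termwise on `E ∈ [E₀, E_T)`, `j + τ ≤ E` (`τ ≤ 1`; from a box table by
`ruleM_twoSign_of_boxTable`) and the apex inequality (T) at `(φ_lo, E_T)` —, the box narrow enough
(`v_k^{φ_hi−φ_lo}, u_k^{φ_hi−φ_lo} ≥ 1/2`): a `Δ`-cell `[a, b)` with head level `n_F`
(`a + n_F + 1 ≥ E₀`), rule bits `useChord` / `useInterval` with their side conditions, and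
`headCellNumber₂ ≥ 0` give `TensorPositive N` at every `Δ ∈ [a, b)`, every `p ∈ Q`.
[cite: HogervorstRychkov2013, §3 eq. (3.9)] -/
theorem tensorCell_of_headNumber₂ {n : ℕ} (z zb : Fin n → ℝ) (w : Fin 7 → Fin n → ℝ) (N : ℕ)
    (hz : ∀ k, z k ∈ Ioo (0 : ℝ) 1) (hzb : ∀ k, zb k ∈ Ioo (0 : ℝ) 1) (hord : ∀ k, zb k ≤ z k)
    (a₀ : Fin n) (hapex : 0 ≤ tensorMinusWeights w N a₀ + tensorPlusWeights w N a₀)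
    (qd qr : Fin n → ℝ) (hqd : ∀ k, 0 < qd k ∧ qd k ≤ 1) (hqr : ∀ k, 0 < qr k ∧ qr k ≤ 1)
    (hdomd : ∀ k, z k * zb k ≤ qd k ^ 2 * (z a₀ * zb a₀) ∧ z k ≤ qd k * z a₀)
    (hdomr : ∀ k, (1 - z k) * (1 - zb k) ≤ qr k ^ 2 * (z a₀ * zb a₀) ∧ 1 - zb k ≤ qr k * z a₀)
    {Q : Set (ℝ × ℝ)} {φlo φhi E₀ ET τ : ℝ} (hQ : ∀ p ∈ Q, φlo ≤ p.1 ∧ p.1 ≤ φhi) (hτ1 : τ ≤ 1)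
    (hM : ∀ (j : ℕ) (E : ℝ), E₀ ≤ E → E < ET → (j : ℝ) + τ ≤ E → ∀ s ∈ Icc φlo φhi,
      0 ≤ twoSignTerm (tensorMinusWeights w N) (tensorPlusWeights w N) z zb s E j)
    (hB : apexRest₂ (tensorMinusWeights w N + tensorPlusWeights w N)
        (tensorMinusWeights w N - tensorPlusWeights w N) z zb a₀ qd qr φlo ET ≤
      (tensorMinusWeights w N a₀ + tensorPlusWeights w N a₀) * ((1 - z a₀) * (1 - zb a₀)) ^ φhi)
    (hr : ∀ k, 1 / 2 ≤ ((1 - z k) * (1 - zb k)) ^ (φhi - φlo) ∧ 1 / 2 ≤ (z k * zb k) ^ (φhi - φlo))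
    {ℓ : ℕ} {a b : ℝ} (nF : ℕ) (hnF : E₀ ≤ a + ((nF : ℝ) + 1)) (useChord useInterval : Bool)
    (h1 : useInterval = false → (ℓ : ℝ) + 1 ≤ a)
    (h2 : useInterval = true → unitarityBound3D ℓ < a ∧ (ℓ : ℝ) + τ ≤ a)
    (hρ : useChord = true → ∀ k, 1 / 2 ≤ (z k * zb k) ^ ((b - a) / 2) ∧
      1 / 2 ≤ ((1 - z k) * (1 - zb k)) ^ ((b - a) / 2))
    (hnum : 0 ≤ headCellNumber₂ (tensorMinusWeights w N) (tensorPlusWeights w N) z zb ℓ a b φlo φhi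
      nF useChord useInterval) :
    ∀ p ∈ Q, ∀ Δ ∈ Ico a b, (ofPoints z zb w).TensorPositive N p.1 Δ ℓ :=
  fun p hp Δ hΔ => (tensorPositive_ofPoints_iff_twoSignPositive z zb w N p.1 Δ ℓ).2
    (headCell₂_twoSign_of_rules _ _ z zb hz hzb hord a₀ hapex qd qr hqd hqr hdomd hdomr hτ1 hM hB hr
      nF hnF useChord useInterval h1 h2 hρ hnum p.1 ⟨(hQ p hp).1, (hQ p hp).2⟩ Δ hΔ)

/-- **One light `A` cell from its number** — likewise with the `A` combined weights.
[cite: HogervorstRychkov2013, §3 eq. (3.9)] -/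
theorem antiCell_of_headNumber₂ {n : ℕ} (z zb : Fin n → ℝ) (w : Fin 7 → Fin n → ℝ)
    (hz : ∀ k, z k ∈ Ioo (0 : ℝ) 1) (hzb : ∀ k, zb k ∈ Ioo (0 : ℝ) 1) (hord : ∀ k, zb k ≤ z k)
    (a₀ : Fin n) (hapex : 0 ≤ antiMinusWeights w a₀ + antiPlusWeights w a₀)
    (qd qr : Fin n → ℝ) (hqd : ∀ k, 0 < qd k ∧ qd k ≤ 1) (hqr : ∀ k, 0 < qr k ∧ qr k ≤ 1)
    (hdomd : ∀ k, z k * zb k ≤ qd k ^ 2 * (z a₀ * zb a₀) ∧ z k ≤ qd k * z a₀)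
    (hdomr : ∀ k, (1 - z k) * (1 - zb k) ≤ qr k ^ 2 * (z a₀ * zb a₀) ∧ 1 - zb k ≤ qr k * z a₀)
    {Q : Set (ℝ × ℝ)} {φlo φhi E₀ ET τ : ℝ} (hQ : ∀ p ∈ Q, φlo ≤ p.1 ∧ p.1 ≤ φhi) (hτ1 : τ ≤ 1)
    (hM : ∀ (j : ℕ) (E : ℝ), E₀ ≤ E → E < ET → (j : ℝ) + τ ≤ E → ∀ s ∈ Icc φlo φhi,
      0 ≤ twoSignTerm (antiMinusWeights w) (antiPlusWeights w) z zb s E j)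
    (hB : apexRest₂ (antiMinusWeights w + antiPlusWeights w) (antiMinusWeights w - antiPlusWeights w)
        z zb a₀ qd qr φlo ET ≤
      (antiMinusWeights w a₀ + antiPlusWeights w a₀) * ((1 - z a₀) * (1 - zb a₀)) ^ φhi)
    (hr : ∀ k, 1 / 2 ≤ ((1 - z k) * (1 - zb k)) ^ (φhi - φlo) ∧ 1 / 2 ≤ (z k * zb k) ^ (φhi - φlo))
    {ℓ : ℕ} {a b : ℝ} (nF : ℕ) (hnF : E₀ ≤ a + ((nF : ℝ) + 1)) (useChord useInterval : Bool)
    (h1 : useInterval = false → (ℓ : ℝ) + 1 ≤ a)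
    (h2 : useInterval = true → unitarityBound3D ℓ < a ∧ (ℓ : ℝ) + τ ≤ a)
    (hρ : useChord = true → ∀ k, 1 / 2 ≤ (z k * zb k) ^ ((b - a) / 2) ∧
      1 / 2 ≤ ((1 - z k) * (1 - zb k)) ^ ((b - a) / 2))
    (hnum : 0 ≤ headCellNumber₂ (antiMinusWeights w) (antiPlusWeights w) z zb ℓ a b φlo φhi nF
      useChord useInterval) :
    ∀ p ∈ Q, ∀ Δ ∈ Ico a b, (ofPoints z zb w).AntiPositive p.1 Δ ℓ :=
  fun p hp Δ hΔ => (antiPositive_ofPoints_iff_twoSignPositive z zb w p.1 Δ ℓ).2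
    (headCell₂_twoSign_of_rules _ _ z zb hz hzb hord a₀ hapex qd qr hqd hqr hdomd hdomr hτ1 hM hB hr
      nF hnF useChord useInterval h1 h2 hρ hnum p.1 ⟨(hQ p hp).1, (hQ p hp).2⟩ Δ hΔ)

/-! ### Light `T` / `A` rows from cell lists -/

/-- **A covered `T` range from cells.** [cite: KosPolandSimmonsDuffinVichi2015, §2.2 (functional conditions)] -/
theorem tensorPositive_of_cells {n : ℕ} (z zb : Fin n → ℝ) (w : Fin 7 → Fin n → ℝ) (N : ℕ)
    {Q : Set (ℝ × ℝ)} {ℓ : ℕ} (t : ℕ → ℝ) (m : ℕ) {lo hi : ℝ} (hlo : t 0 ≤ lo) (hhi : hi ≤ t m)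
    (hcell : ∀ i < m, ∀ p ∈ Q, ∀ Δ ∈ Ico (t i) (t (i + 1)),
      (ofPoints z zb w).TensorPositive N p.1 Δ ℓ) :
    ∀ p ∈ Q, ∀ Δ : ℝ, lo ≤ Δ → Δ < hi → (ofPoints z zb w).TensorPositive N p.1 Δ ℓ :=
  cells_cover (fun p Δ => (ofPoints z zb w).TensorPositive N p.1 Δ ℓ) t m hlo hhi hcell

/-- **A covered `A` range from cells.** [cite: KosPolandSimmonsDuffinVichi2015, §2.2 (functional conditions)] -/
theorem antiPositive_of_cells {n : ℕ} (z zb : Fin n → ℝ) (w : Fin 7 → Fin n → ℝ)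
    {Q : Set (ℝ × ℝ)} {ℓ : ℕ} (t : ℕ → ℝ) (m : ℕ) {lo hi : ℝ} (hlo : t 0 ≤ lo) (hhi : hi ≤ t m)
    (hcell : ∀ i < m, ∀ p ∈ Q, ∀ Δ ∈ Ico (t i) (t (i + 1)), (ofPoints z zb w).AntiPositive p.1 Δ ℓ) :
    ∀ p ∈ Q, ∀ Δ : ℝ, lo ≤ Δ → Δ < hi → (ofPoints z zb w).AntiPositive p.1 Δ ℓ :=
  cells_cover (fun p Δ => (ofPoints z zb w).AntiPositive p.1 Δ ℓ) t m hlo hhi hcell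

/-- **The item `scalar_T` from a cell list**: cells covering `[max(Δ_T^*, 1/2), E₀)`.
[cite: KosPolandSimmonsDuffinVichi2015, §2.2 (functional conditions)] -/
theorem scalar_T_of_cells {n : ℕ} (z zb : Fin n → ℝ) (w : Fin 7 → Fin n → ℝ) (N : ℕ)
    {Q : Set (ℝ × ℝ)} {ΔTstar E₀ : ℝ} (t : ℕ → ℝ) (m : ℕ)
    (hlo : t 0 ≤ max ΔTstar (1 / 2)) (hhi : E₀ ≤ t m)
    (hcell : ∀ i < m, ∀ p ∈ Q, ∀ Δ ∈ Ico (t i) (t (i + 1)),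
      (ofPoints z zb w).TensorPositive N p.1 Δ 0) :
    ∀ p ∈ Q, ∀ Δ : ℝ, ΔTstar ≤ Δ → 1 / 2 ≤ Δ → Δ < E₀ → (ofPoints z zb w).TensorPositive N p.1 Δ 0 :=
  fun p hp Δ hg hb hE => tensorPositive_of_cells z zb w N t m le_rfl hhi hcell p hp Δ
    (hlo.trans (max_le hg hb)) hE

/-- **The item `spinning_T` of one spin from a cell list**: cells covering `[ℓ+1, E₀)`.
[cite: KosPolandSimmonsDuffinVichi2015, §2.2 (functional conditions)] -/
theorem spinning_T_of_cells {n : ℕ} (z zb : Fin n → ℝ) (w : Fin 7 → Fin n → ℝ) (N : ℕ)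
    {Q : Set (ℝ × ℝ)} {ℓ : ℕ} {E₀ : ℝ} (t : ℕ → ℝ) (m : ℕ)
    (hlo : t 0 ≤ (ℓ : ℝ) + 1) (hhi : E₀ ≤ t m)
    (hcell : ∀ i < m, ∀ p ∈ Q, ∀ Δ ∈ Ico (t i) (t (i + 1)),
      (ofPoints z zb w).TensorPositive N p.1 Δ ℓ) :
    ∀ p ∈ Q, ∀ Δ : ℝ, (ℓ : ℝ) + 1 ≤ Δ → Δ < E₀ → (ofPoints z zb w).TensorPositive N p.1 Δ ℓ :=
  tensorPositive_of_cells z zb w N t m hlo hhi hcell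

/-- **The item `spinning_A` of one spin from a cell list**: cells covering `[ℓ+1, E₀)`.
[cite: KosPolandSimmonsDuffinVichi2015, §2.2 (functional conditions)] -/
theorem spinning_A_of_cells {n : ℕ} (z zb : Fin n → ℝ) (w : Fin 7 → Fin n → ℝ)
    {Q : Set (ℝ × ℝ)} {ℓ : ℕ} {E₀ : ℝ} (t : ℕ → ℝ) (m : ℕ)
    (hlo : t 0 ≤ (ℓ : ℝ) + 1) (hhi : E₀ ≤ t m)
    (hcell : ∀ i < m, ∀ p ∈ Q, ∀ Δ ∈ Ico (t i) (t (i + 1)), (ofPoints z zb w).AntiPositive p.1 Δ ℓ) :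
    ∀ p ∈ Q, ∀ Δ : ℝ, (ℓ : ℝ) + 1 ≤ Δ → Δ < E₀ → (ofPoints z zb w).AntiPositive p.1 Δ ℓ :=
  antiPositive_of_cells z zb w t m hlo hhi hcell

end ArchipelagoFunctional

end Literature.MathematicalPhysics.QuantumFieldTheory.ONArchipelagoSystem
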